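import Summits.BirchSwinnertonDyer.BirchSwinnertonDyer.Theorems.GenusKolyvaginAtTwoPowDvdShaCardAtTwoRTTwoPrimeSwap
import Summits.BirchSwinnertonDyer.BirchSwinnertonDyer.Theorems.GenusKolyvaginAtTwoPowDvdShaCardAtTwoRTPrimeSwappingWeak
import HarnessLib

/-!
# Route `GenusKolyvaginAtTwo`, crux L_T `PowDvdShaCardAtTwoRT` (stmt-BirchSwinnertonDyer-23242), LINE 18 stub 3a⁗ —
# Kolyvagin's TWO-PRIME engine feeds the WEAK loop: no third Čebotarev prescription, no Klein-four residue

Seat `bsd-line-gk2-p2` g16 (PROVER seat 2/3, cell `bsd-f1-sign2`), `--supports stmt-BirchSwinnertonDyer-23242` (helper). Pure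
bookkeeping joining LEAD gk2-p1 g15's `…RTTwoPrimeSwap` (`swapOracle_of_twoPrimeReciprocity`, p690930) to this seat's WEAK loop
`…RTPrimeSwappingWeak` (`exists_good_not_mem_of_weakSwapOracle`, `exists_avoiding_of_weakSwapOracle`, p689364). THEOREMS ONLY.
BSD is not proved by this file; neither is the crux or the stub.

WHY. `swapOracle_of_twoPrimeReciprocity` produces the STRONG oracle binder of `exists_good_separating_of_swapOracle`: its Čebotarev
input `hceb` must, besides giving `c_M(∏(S∖ℓ₀))` and `c_M(∏S)` FULL local order at the new prime `ℓ′`, also DETECT an arbitrary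
`c ∈ C[2]` — a THIRD prescription on order-`2` data, which at `p = 2` can be unrealisable (LEAD `…RTKleinDetect`: three non-vanishing
prescriptions `b₁, b₂, b₃` are jointly realisable iff `b₁ + b₂ + b₃ ≠ 0`). The weak loop needs no detection of `c`: it detects only
the bottom class `γ S = c_{M_r+1}(∏S) = 2^{M−M_r−1}·c_M(∏S)` (Lemma 4.6, `…RTLevelCompatibility`), and **full local order of `c_M(∏S)`
at `ℓ′` — which `hceb` prescribes anyway — IS `γ S ∉ A ℓ′`** (order dictionary `…RTKolyvaginClassOrderGeneral`; displayed here as the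
hypothesis `hγA`: «local divisibility of `P_{∏S}` at `λ′` equal to the global one ⟹ the bottom class is non-zero at `λ′`»). So the
two-prime engine's Čebotarev input shrinks to the TWO full-order prescriptions (`…RTFullOrderPairChebotarev`,
`infinite_kolyvaginPrime_localization_fullOrder_pair`, signed, dependent case by socles) and the loop still returns, for every `s ⊆ R`
with `#s ≤ r`, a ladder class avoiding `⟨s⟩`.

* `weakSwapOracle_of_twoPrimeReciprocity` — LEAD's deduction verbatim (adapted from `…RTTwoPrimeSwap`, the `c`-clause dropped, the
  `γ`-clause read off `dl S ℓ′ = m S` by `hγA`): the WEAK oracle binder.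
* `exists_avoiding_of_twoPrimeReciprocity_weak` — plugged into `exists_avoiding_of_weakSwapOracle`: ONE RUNG of the supply from the
  two-prime engine with two prescriptions only.

References: [Kolyvagin1991MathAnn] Thm. 2.1; [McCallumLMS1991] §5 Prop. 5.2 (proof), Prop. 4.4, §4 Lemma 4.6.
-/

set_option autoImplicit false
-- `Summit.<P>.<Sub>` repeats `BirchSwinnertonDyer` by the tree's layout convention (D-0017)
set_option linter.dupNamespace false

namespace Summit.BirchSwinnertonDyer.BirchSwinnertonDyer.Theorems.GenusExact.PlusDescent

open Finset

section TwoPrimeWeak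

variable {V : Type*} [AddCommGroup V]

/-- **The WEAK swap oracle from Kolyvagin's two-prime reciprocity.** Data and hypotheses of LEAD's
`swapOracle_of_twoPrimeReciprocity` with the detection clause REMOVED from `hceb` (now: a new admissible `ℓ′ ∉ S` at which
`P_{∏(S∖ℓ₀)}` and `P_{∏S}` have local `2`-divisibility equal to their global one), plus the detected-class dictionary `hγA`: at an
admissible `ℓ ∉ S` with `dl S ℓ = m S` (full local order of `c_M(∏S)`), the bottom class `γ S` is NOT in the strict condition `A ℓ`.
Conclusion: the `oracle` binder of `exists_good_not_mem_of_weakSwapOracle` — for admissible `S` and `ℓ₀ ∈ S`, a good `ℓ′ ∉ S` with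
`insert ℓ′ (S ∖ ℓ₀)` admissible and `γ S ∉ A ℓ′`. The divisibility bookkeeping (two-term identity under its guard, `m ≤ dl`,
minimality) is LEAD's, verbatim. [cite: Kolyvagin1991MathAnn, Thm. 2.1 (proof via [1, Prop. 8])]
[cite: McCallumLMS1991, §5 Prop. 5.2 (proof), Prop. 4.4] -/
theorem weakSwapOracle_of_twoPrimeReciprocity
    (A : ℕ → AddSubgroup V) (good adm : ℕ → Prop) (Inv : Finset ℕ → Prop)
    (m : Finset ℕ → ℕ) (dl : Finset ℕ → ℕ → ℕ) (M Mr r : ℕ) (γ : Finset ℕ → V)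
    (hgood : ∀ l, adm l → good l)
    (hInv_out : ∀ S, Inv S → S.card = r ∧ (∀ l ∈ S, adm l) ∧ m S = Mr)
    (hInv_in : ∀ S, S.card = r → (∀ l ∈ S, adm l) → m S = Mr → Inv S)
    (hmin : ∀ S, S.card = r → (∀ l ∈ S, adm l) → Mr ≤ m S)
    (hloc : ∀ S l, (∀ l' ∈ S, adm l') → adm l → l ∉ S → m S ≤ dl S l)
    (hceb : ∀ S, Inv S → ∀ l₀ ∈ S, ∃ l', l' ∉ S ∧ adm l' ∧
      dl (S.erase l₀) l' = m (S.erase l₀) ∧ dl S l' = m S)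
    (hrec : ∀ S, Inv S → ∀ l₀ ∈ S, ∀ l', l' ∉ S → adm l' →
      dl (S.erase l₀) l' + dl S l' + 2 ≤ M →
      dl (S.erase l₀) l' + dl S l' = dl (S.erase l₀) l₀ + dl (insert l' (S.erase l₀)) l₀)
    (hM : ∀ S, Inv S → ∀ l₀ ∈ S, m (S.erase l₀) + Mr + 2 ≤ M)
    (hγA : ∀ S l, Inv S → adm l → l ∉ S → dl S l = m S → γ S ∉ A l) :
    ∀ S, Inv S → ∀ l₀ ∈ S, ∃ l', l' ∉ S ∧ good l' ∧ Inv (insert l' (S.erase l₀)) ∧ γ S ∉ A l' := by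
  classical
  intro S hS l₀ hl₀
  obtain ⟨hcard, hadm, hmS⟩ := hInv_out S hS
  obtain ⟨l', hl'S, hl'adm, hd₀, hdS⟩ := hceb S hS l₀ hl₀
  refine ⟨l', hl'S, hgood l' hl'adm, ?_, hγA S l' hS hl'adm hl'S hdS⟩
  -- (adapted from LEAD gk2-p1 g15 `swapOracle_of_twoPrimeReciprocity`, `…RTTwoPrimeSwap`)
  -- admissible primes of the pieces
  have hadm₀ : ∀ l ∈ S.erase l₀, adm l := fun l hl ↦ hadm l (Finset.mem_of_mem_erase hl)
  have hadm' : ∀ l ∈ insert l' (S.erase l₀), adm l := by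
    intro l hl
    rcases Finset.mem_insert.mp hl with rfl | hl
    · exact hl'adm
    · exact hadm₀ l hl
  have hl₀' : l₀ ∉ insert l' (S.erase l₀) := by
    intro h
    rcases Finset.mem_insert.mp h with h | h
    · exact hl'S (h ▸ hl₀)
    · exact (Finset.notMem_erase l₀ S) h
  have hcard' : (insert l' (S.erase l₀)).card = r := by
    rw [Finset.card_insert_of_notMem (fun h ↦ hl'S (Finset.mem_of_mem_erase h)), Finset.card_erase_of_mem hl₀, hcard]
    have : 0 < S.card := Finset.card_pos.mpr ⟨l₀, hl₀⟩
    omega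
  -- the two-term identity is informative
  have hguard : dl (S.erase l₀) l' + dl S l' + 2 ≤ M := by
    rw [hd₀, hdS, hmS]
    exact hM S hS l₀ hl₀
  have hid := hrec S hS l₀ hl₀ l' hl'S hl'adm hguard
  rw [hd₀, hdS, hmS] at hid
  -- `m(S∖l₀) ≤ dl (S∖l₀) l₀`, so the new local divisibility at `l₀` is `≤ Mr`
  have h1 : m (S.erase l₀) ≤ dl (S.erase l₀) l₀ :=
    hloc (S.erase l₀) l₀ hadm₀ (hadm l₀ hl₀) (Finset.notMem_erase l₀ S)
  have h2 : dl (insert l' (S.erase l₀)) l₀ ≤ Mr := by omega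
  -- hence the new global divisibility is `≤ Mr`, hence `= Mr`
  have h3 : m (insert l' (S.erase l₀)) ≤ Mr :=
    (hloc _ l₀ hadm' (hadm l₀ hl₀) hl₀').trans h2
  have h4 : Mr ≤ m (insert l' (S.erase l₀)) := hmin _ hcard' hadm'
  exact hInv_in _ hcard' hadm' (le_antisymm h3 h4)

/-- **ONE RUNG OF THE SUPPLY from the two-prime engine with TWO prescriptions only**: the hypotheses of
`weakSwapOracle_of_twoPrimeReciprocity` fed into `exists_avoiding_of_weakSwapOracle` — with the ladder class `cls S ∈ R`
(`p^a ∣ ord (cls S)`, `cls S ∈ A l` for `l ∈ S`) and its socle `γ S ∈ ⟨cls S⟩`, `γ S ≠ 0`, `p·γ S = 0` for admissible all-good `S`: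
every `s ⊆ R` with `#s ≤ r` is avoided by some `z ∈ R` with `p^a ∣ ord z`. No subgroup `C` is ever shown to the engine.
[cite: McCallumLMS1991, §5 Prop. 5.2] [cite: Kolyvagin1991MathAnn, Thm. 2.1] -/
theorem exists_avoiding_of_twoPrimeReciprocity_weak {p : ℕ} (hp : p.Prime) {M₀ : ℕ} (hV : ∀ v : V, p ^ M₀ • v = 0)
    (R : AddSubgroup V) [Finite R] (A : ℕ → AddSubgroup V) (good adm : ℕ → Prop) (r : ℕ) (Inv : Finset ℕ → Prop)
    (m : Finset ℕ → ℕ) (dl : Finset ℕ → ℕ → ℕ) (M Mr : ℕ)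
    (hgood : ∀ l, adm l → good l)
    (hInv_out : ∀ S, Inv S → S.card = r ∧ (∀ l ∈ S, adm l) ∧ m S = Mr)
    (hInv_in : ∀ S, S.card = r → (∀ l ∈ S, adm l) → m S = Mr → Inv S)
    (hmin : ∀ S, S.card = r → (∀ l ∈ S, adm l) → Mr ≤ m S)
    (hloc : ∀ S l, (∀ l' ∈ S, adm l') → adm l → l ∉ S → m S ≤ dl S l)
    (hceb : ∀ S, Inv S → ∀ l₀ ∈ S, ∃ l', l' ∉ S ∧ adm l' ∧
      dl (S.erase l₀) l' = m (S.erase l₀) ∧ dl S l' = m S)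
    (hrec : ∀ S, Inv S → ∀ l₀ ∈ S, ∀ l', l' ∉ S → adm l' →
      dl (S.erase l₀) l' + dl S l' + 2 ≤ M →
      dl (S.erase l₀) l' + dl S l' = dl (S.erase l₀) l₀ + dl (insert l' (S.erase l₀)) l₀)
    (hM : ∀ S, Inv S → ∀ l₀ ∈ S, m (S.erase l₀) + Mr + 2 ≤ M)
    (hK : ∀ l, good l → ∀ s : Finset V, (↑s : Set V) ⊆ R →
      (A l).relIndex (AddSubgroup.closure (↑s : Set V) ⊓ AddSubgroup.torsionBy V (p : ℤ)) ∣ p)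
    (S₀ : Finset ℕ) (hS₀ : Inv S₀)
    (cls γ : Finset ℕ → V) {a : ℕ}
    (hcls : ∀ S, Inv S → (∀ l ∈ S, good l) →
      cls S ∈ R ∧ p ^ a ∣ addOrderOf (cls S) ∧ (∀ l ∈ S, cls S ∈ A l) ∧
      γ S ∈ AddSubgroup.zmultiples (cls S) ∧ γ S ≠ 0 ∧ p • γ S = 0)
    (hγA : ∀ S l, Inv S → adm l → l ∉ S → dl S l = m S → γ S ∉ A l)
    (s : Finset V) (hs : (↑s : Set V) ⊆ R) (hsr : s.card ≤ r) :
    ∃ z ∈ R, p ^ a ∣ addOrderOf z ∧ Disjoint (AddSubgroup.zmultiples z) (AddSubgroup.closure (↑s : Set V)) :=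
  exists_avoiding_of_weakSwapOracle hp hV R A good r Inv (fun S hS ↦ (hInv_out S hS).1) hK S₀ hS₀ cls γ hcls
    (weakSwapOracle_of_twoPrimeReciprocity A good adm Inv m dl M Mr r γ hgood hInv_out hInv_in hmin hloc hceb hrec hM hγA)
    s hs hsr

end TwoPrimeWeak

end Summit.BirchSwinnertonDyer.BirchSwinnertonDyer.Theorems.GenusExact.PlusDescent
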